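import Summits.CriticalPhenomena.PercolationContinuityZ3.Theorems.Transplant.SkelFrmBParamsFaceFloorsHypsF
import Summits.CriticalPhenomena.PercolationContinuityZ3.Theorems.Transplant.SkelFrmBParamsFaceFloorsX2WB
import Summits.CriticalPhenomena.PercolationContinuityZ3.Theorems.Transplant.SkelPhiFaceNumsXP2V
import HarnessLib
import Summits.CriticalPhenomena.PercolationContinuityZ3.Theorems.Transplant.SkelFrmBParamsFaceFloorsYY2HFW

/-!
# N2 (frames-only node, OPEN) — (F) column under (R-44)(c)/(R-48), DISCHARGE LAYER: **THE ONE-SIDED x-FACE FLOORS IN THE V PROVIDER's PREMISE SHAPE**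
# (hp-8 g43; the W twin of `KS.floorsX_XFs_F`, SkelFrmBParamsFaceFloorsXY2HF)

The `floors` premise of `Skelφ.numsX_provider₂EV` (SkelPhiFaceNumsXP2V, DESIGN W) reads, per kit centre with cell point `z`: ONWARD step (`du.2 = true`),
the level window `faceL − E ≤ lev ≤ faceL + E`, and the contact ABOUT THE SHIFTED WINDOW CENTRE `|z⊥ − (cenS x⊥ + P.faceSh du)| ≤ kE` — and wants
`Skelφ.FloorsX2V … P …`. This file supplies it from the one-sided assembly `KS.floorsX2_XFsW` (X2WB) at `P.toPCells2T` and `FloorsX2V.ofT`, at any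
dominating slot value (`gx ⊒ gxFc`, `fx ⊒ fxFc`, ResidF) with the ×Kq/cell/band rows discharged by HypsF (`slotsF_hyps/cellsF_hyps/bandF_facts`), and with
the THREE contact rows of the V cells kept as hypotheses on the window reach `kE` (their dischargers are p1-g18's F-K1 part 2 rows over `PCells2V.faceExt`
and stmt's `hFR`/`small…` instance of record — numerals not read here): `hkEr : kE + r₁ ≤ 5·r₁`, `hkE2 : 2·(kE + r₁) + 8u₁ + 8 + 2·c₀ ≤ 5·r₁`, and
**the forward-start row `hfwd : 2·kE + hF₀ − hB₀ + 6·u₁ ≤ 2·(c₀ + bwX)`** (⇒ `3·u₁ ≤ T1X + bwX` at every such centre, using `|faceSh| ≤ r⊥`,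
`2·⌊(hF−hB)/2⌋ ≤ hF − hB`, `sgOf du = 1`, `cenS_step_one`).
NON-VACUITY: premises = XY2HF's + the three named rows (instances of record: p1-g18 `kFF₂V`, stmt-g21 `hFR`).
builds on p205010 (kernel theorem, internal audit signed; external expert review pending) — nothing here uses p205010; NOTHING is claimed about the open node
`SamePDropOfSkeletonFrm₁`.
Lane `prim-bschramm`, seat `prim-hp-8` (gen 43); helper file (`--supports stmt-CriticalPhenomena-4575 --as helper`).
* `KS.hTw_of_shiftedX` (the forward-start premise from the shifted reading), **`KS.floorsX_XFs_FW`**.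
[cite: KozmaNitzan2024, §4 Lemma 11–12 (pp. 21–25)] [cite: MartineauTassion2017, §4.3]
-/

noncomputable section

open scoped Classical

namespace Summit.CriticalPhenomena.PercolationContinuityZ3.Theorems.Transplant

namespace PlanarSkeletonFrm

namespace NegB

namespace KS

open Literature.Probability.Percolation Literature.Probability.LatticeModels SimpleGraph
open Literature.Probability.Percolation.KozmaNitzan.Cells (oth sgOf sgOf_sign)
open SkelConc (Consts)
open Skelφ.StepI (DataNS)
open TwoAxis.Para (modulus)
open Neg

/-- **The forward-start premise from DESIGN W's shifted reading** (x-face, onward step): `|z₁ − (cenS x₁ + faceSh du)| ≤ kE`, `du.2 = true` and the row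
`2·kE + hF₀ − hB₀ + 6·u₁ ≤ 2·(c₀ + bw)` give `3·u₁ ≤ T1X P.toPCells2T x du z + bw` (and `|z₁ − cenS x₁| ≤ kE + r₁`). [this work] -/
theorem hTw_of_shiftedX (κ : Consts) {V : Type} [DecidableEq V] [Countable V] {G : SimpleGraph V} [G.LocallyFinite] (Φ : PlanarSkeletonFrm G) (t : V) (p : unitInterval) (D : Skelφ.StepI.DataNS V) (g f : ℕ)
    (P : PCells2V) (x : Site 2) (du : MDir) (hd : du.1 = 0) (hs : du.2 = true) (z : Site 2) {kE : ℤ} {bw : ℕ}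
    (hzW : |z 1 - (P.cenS x 1 + P.faceSh du)| ≤ kE)
    (hfwd : 2 * kE + (P.hF 0 : ℤ) - P.hB 0 + 6 * u₁A κ Φ t p D g f ≤ 2 * ((P.c 0 : ℤ) + bw)) :
    3 * u₁A κ Φ t p D g f ≤ T1X P.toPCells2T x du z + bw ∧ |z 1 - P.cenS x 1| ≤ kE + (P.r 1 : ℤ) := by
  have hsg : sgOf du = 1 := by unfold sgOf; rw [hs]; rfl
  have hsh := P.abs_faceSh_le du
  rw [hd, show oth (0 : Fin 2) = 1 from rfl] at hsh
  obtain ⟨s1, s2⟩ := abs_le.1 hsh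
  obtain ⟨w1, w2⟩ := abs_le.1 hzW
  have e : T1X P.toPCells2T x du z = -(z 1 - P.cenS x 1) + sgOf du * (P.c 0 : ℤ) := by
    unfold T1X; rw [cenS_step_one P.toPCells2T x du hd]; ring
  have hfs : P.faceSh du = ((P.hF 0 : ℤ) - P.hB 0) / 2 := by unfold PCells2V.faceSh; rw [hsg, hd, one_mul]
  refine ⟨?_, abs_le.2 ⟨by linarith, by linarith⟩⟩
  rw [e, hsg, one_mul]
  rw [hfs] at w2
  have hdiv : 2 * (((P.hF 0 : ℤ) - P.hB 0) / 2) ≤ (P.hF 0 : ℤ) - P.hB 0 := Int.mul_ediv_self_le (by norm_num)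
  linarith

set_option maxHeartbeats 1600000 in
/-- **THE ONE-SIDED x-FACE FLOORS IN THE V PROVIDER's PREMISE SHAPE** (see the module docstring). [cite: KozmaNitzan2024, §4 Lemma 11–12 (pp. 21–25)] -/
theorem floorsX_XFs_FW (κ : Consts) {V : Type} [DecidableEq V] [Countable V] {G : SimpleGraph V} [G.LocallyFinite] (Φ : PlanarSkeletonFrm G) (t : V) (p : unitInterval) (D : Skelφ.StepI.DataNS V) (c mk : ℕ) (gx fx : Neg.FSlot)
    (hgx : ∀ D : DataNS V, gxFc mk c κ Φ t p D ≤ gx κ Φ t p D) (hfx : ∀ D : DataNS V, fxFc mk κ Φ t p D ≤ fx κ Φ t p D)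
    (hN : EqNumL κ Φ t p D (gT mk gx κ Φ t p D) (fT mk fx κ Φ t p D)) (hκ : (hL κ Φ t p D (gT mk gx κ Φ t p D) (fT mk fx κ Φ t p D)).natAbs ≤ 10 * nL κ Φ t p D (gT mk gx κ Φ t p D) (fT mk fx κ Φ t p D))
    (P : PCells2V) (hP : P.toPCells2 = fcellsA κ Φ t p D (gT mk gx κ Φ t p D) (fT mk fx κ Φ t p D)) {kE : ℤ}
    (hkEr : kE + (P.r 1 : ℤ) ≤ 5 * (P.r 1 : ℤ))
    (hkE2 : 2 * (kE + (P.r 1 : ℤ)) + 8 * u₁A κ Φ t p D (gT mk gx κ Φ t p D) (fT mk fx κ Φ t p D) + 8 + 2 * (P.c 0 : ℤ) ≤ 5 * (P.r 1 : ℤ))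
    (hfwd : 2 * kE + (P.hF 0 : ℤ) - P.hB 0 + 6 * u₁A κ Φ t p D (gT mk gx κ Φ t p D) (fT mk fx κ Φ t p D) ≤ 2 * ((P.c 0 : ℤ) + (bwX κ Φ t p D (gT mk gx κ Φ t p D) (fT mk fx κ Φ t p D))))
    (r : ℕ) (hr : πBudX κ Φ t p D c mk (gT mk gx κ Φ t p D) (fT mk fx κ Φ t p D) ≤ r) :
    ∀ (x : Site 2) (du : MDir) (j : ℕ) (z : Site 2), du.1 = 0 → du.2 = true → j < P.K →
      P.faceL du.1 j - (((KS0.Rlev0 κ Φ t p D mk + KS0.reach0 t D mk) : ℕ) : ℤ) ≤ P.lev du x z → P.lev du x z ≤ P.faceL du.1 j + (((KS0.Rlev0 κ Φ t p D mk + KS0.reach0 t D mk) : ℕ) : ℤ) →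
      |z (oth du.1) - (P.cenS x (oth du.1) + P.faceSh du)| ≤ kE →
      Skelφ.FloorsX2V (prFA κ Φ t p D (gT mk gx κ Φ t p D) (fT mk fx κ Φ t p D)) (nL κ Φ t p D (gT mk gx κ Φ t p D) (fT mk fx κ Φ t p D)) (u₀A κ Φ t p D (gT mk gx κ Φ t p D) (fT mk fx κ Φ t p D)) (u₁A κ Φ t p D (gT mk gx κ Φ t p D) (fT mk fx κ Φ t p D))
      (modulus (nL κ Φ t p D (gT mk gx κ Φ t p D) (fT mk fx κ Φ t p D)) (hL κ Φ t p D (gT mk gx κ Φ t p D) (fT mk fx κ Φ t p D)) (vL κ Φ t p D (gT mk gx κ Φ t p D) (fT mk fx κ Φ t p D)) (vβL κ Φ t p D (gT mk gx κ Φ t p D) (fT mk fx κ Φ t p D))) (nL κ Φ t p D (gT mk gx κ Φ t p D) (fT mk fx κ Φ t p D) : ℤ) (ℓL κ Φ t p D (gT mk gx κ Φ t p D) (fT mk fx κ Φ t p D))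
      P (NegB.BSlot.small3 κ Φ t p D (gT mk gx κ Φ t p D) (fT mk fx κ Φ t p D)) x du j 3 r (Mu D) z
      (fun i => if i = 0 then kF₀A κ Φ t p D c mk (gT mk gx κ Φ t p D) (fT mk fx κ Φ t p D) else kF₁A κ Φ t p D c mk (gT mk gx κ Φ t p D) (fT mk fx κ Φ t p D))
      (BFs κ Φ t p D c mk (gT mk gx κ Φ t p D) (fT mk fx κ Φ t p D) (sgOf du)) (KS0.R'0 κ Φ t p D mk) (qBXFs κ Φ t p D mk) (KS0.R'0 κ Φ t p D mk) (qB3XA κ Φ t p D (gT mk gx κ Φ t p D) (fT mk fx κ Φ t p D) (KS0.R'0 κ Φ t p D mk))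
      (yLXFs κ Φ t p D c mk (gT mk gx κ Φ t p D) (fT mk fx κ Φ t p D) (sgOf du)) (NrX κ Φ t p D (gT mk gx κ Φ t p D) (fT mk fx κ Φ t p D) P.toPCells2T (yLXFs κ Φ t p D c mk (gT mk gx κ Φ t p D) (fT mk fx κ Φ t p D) (sgOf du)) 1 x du z) (N3WX κ Φ t p D (gT mk gx κ Φ t p D) (fT mk fx κ Φ t p D) P.toPCells2T (yLXFs κ Φ t p D c mk (gT mk gx κ Φ t p D) (fT mk fx κ Φ t p D) (sgOf du)) x du z (bwX κ Φ t p D (gT mk gx κ Φ t p D) (fT mk fx κ Φ t p D))) 1 := by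
  intro x du j z hd hs hj hlev1 hlev2 hzW
  obtain ⟨hnA, hnA24, hℓA, hS, hS64, hMR0, hMR0K, hRn0⟩ := slotsF_hyps κ Φ t p D c mk gx fx hgx hfx hN
  obtain ⟨hs0, hs1, hu2, hkF0, hkF1⟩ := cellsF_hyps κ Φ t p D c mk gx fx hgx hN hκ
  obtain ⟨hE2, -, hEu0, -⟩ := bandF_facts κ Φ t p D c mk gx fx hgx hN hκ
  rw [hd, show oth (0 : Fin 2) = 1 from rfl] at hzW
  have hd' : du.1 = 0 := hd
  have hP' : P.toPCells2T.toPCells2 = fcellsA κ Φ t p D (gT mk gx κ Φ t p D) (fT mk fx κ Φ t p D) := hP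
  obtain ⟨hTw, hz'⟩ := hTw_of_shiftedX κ Φ t p D (gT mk gx κ Φ t p D) (fT mk fx κ Φ t p D) P x du hd' hs z hzW hfwd
  have hlev1' : (P.toPCells2T.faceL 0 j : ℤ) - (((KS0.Rlev0 κ Φ t p D mk + KS0.reach0 t D mk) : ℕ) : ℤ) ≤ P.toPCells2T.lev du x z := by rw [hd] at hlev1; exact hlev1
  have hlev2' : P.toPCells2T.lev du x z ≤ P.toPCells2T.faceL 0 j + (((KS0.Rlev0 κ Φ t p D mk + KS0.reach0 t D mk) : ℕ) : ℤ) := by rw [hd] at hlev2; exact hlev2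
  exact Skelφ.FloorsX2V.ofT (floorsX2_XFsW κ Φ t p D c mk gx fx P.toPCells2T hP' hN hκ hnA hℓA hnA24 hS hMR0 hu2 hs0 hkF0 hkF1 x du hd' j hj z hlev1' hlev2' hz' hEu0
    hkEr hkE2 hE2 hTw r hr)

end KS

end NegB

end PlanarSkeletonFrm

end Summit.CriticalPhenomena.PercolationContinuityZ3.Theorems.Transplant

end


/-!
# N2 (frames-only node, OPEN) — (F) column under (R-44)(c)/(R-48), DISCHARGE LAYER: **THE ONE-SIDED FACE FLOOR PACKAGES WITH CAPPED WITNESSES**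
# (hp-8 g43; the W twin of SkelFrmBParamsFaceFloorsPkgF)

The keystone's numbers binders take choice FUNCTIONS `NrF/N3F` with a uniform stride budget `0 + 1 + NrF + 1 + N3F ≤ nB` (`hnFx/hnFy`). As in PkgF the
one-sided counts are CAPPED (`min (Nr…) (600·Kq − 1)`, `min (N3W…) (240·Kq + 9)`); by `rangesX_XFsW/rangesY_YFsW` the caps are inactive at every
admissible contact, so the floors of XY2HFW/YY2HFW transfer verbatim (`floorsX_pkgFW/floorsY_pkgFW`), and the budget holds for any `nB ≥ 840·Kq + 10`
(`capX_pkgFW/capY_pkgFW`). Hop side `1`; the V contact rows, the forward-start rows and `0 ≤ v_L` are kept as hypotheses (see XY2HFW/YY2HFW).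
NON-VACUITY: as XY2HFW/YY2HFW.
builds on p205010 (kernel theorem, internal audit signed; external expert review pending) — nothing here uses p205010; NOTHING is claimed about the open node
`SamePDropOfSkeletonFrm₁`.
Lane `prim-bschramm`, seat `prim-hp-8` (gen 43); helper file (`--supports stmt-CriticalPhenomena-4575 --as helper`).
[cite: KozmaNitzan2024, §4 Lemma 11–12 (pp. 21–25)] [cite: MartineauTassion2017, §4.3]
-/

noncomputable section

open scoped Classical

namespace Summit.CriticalPhenomena.PercolationContinuityZ3.Theorems.Transplant

namespace PlanarSkeletonFrm

namespace NegB

namespace KS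

open Literature.Probability.Percolation Literature.Probability.LatticeModels SimpleGraph
open Literature.Probability.Percolation.KozmaNitzan.Cells (oth sgOf sgOf_sign)
open SkelConc (Consts)
open Skelφ.StepI (DataNS)
open TwoAxis.Para (modulus)
open Neg

set_option maxHeartbeats 1600000 in
/-- **THE ONE-SIDED x-FACE FLOOR PACKAGE WITH CAPPED WITNESSES** (`NrF := min (NrX … 1 …) (600·Kq − 1)`, `N3F := min (N3WX …) (240·Kq + 9)`).
[cite: KozmaNitzan2024, §4 Lemma 11–12 (pp. 21–25)] -/
theorem floorsX_pkgFW (κ : Consts) {V : Type} [DecidableEq V] [Countable V] {G : SimpleGraph V} [G.LocallyFinite] (Φ : PlanarSkeletonFrm G) (t : V) (p : unitInterval) (D : Skelφ.StepI.DataNS V) (c mk : ℕ) (gx fx : Neg.FSlot)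
    (hgx : ∀ D : DataNS V, gxFc mk c κ Φ t p D ≤ gx κ Φ t p D) (hfx : ∀ D : DataNS V, fxFc mk κ Φ t p D ≤ fx κ Φ t p D)
    (hN : EqNumL κ Φ t p D (gT mk gx κ Φ t p D) (fT mk fx κ Φ t p D)) (hκ : (hL κ Φ t p D (gT mk gx κ Φ t p D) (fT mk fx κ Φ t p D)).natAbs ≤ 10 * nL κ Φ t p D (gT mk gx κ Φ t p D) (fT mk fx κ Φ t p D))
    (P : PCells2V) (hP : P.toPCells2 = fcellsA κ Φ t p D (gT mk gx κ Φ t p D) (fT mk fx κ Φ t p D)) {kE : ℤ}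
    (hkEr : kE + (P.r 1 : ℤ) ≤ 5 * (P.r 1 : ℤ))
    (hkE2 : 2 * (kE + (P.r 1 : ℤ)) + 8 * u₁A κ Φ t p D (gT mk gx κ Φ t p D) (fT mk fx κ Φ t p D) + 8 + 2 * (P.c 0 : ℤ) ≤ 5 * (P.r 1 : ℤ))
    (hfwd : 2 * kE + (P.hF 0 : ℤ) - P.hB 0 + 6 * u₁A κ Φ t p D (gT mk gx κ Φ t p D) (fT mk fx κ Φ t p D) ≤ 2 * ((P.c 0 : ℤ) + (bwX κ Φ t p D (gT mk gx κ Φ t p D) (fT mk fx κ Φ t p D))))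
    (r : ℕ) (hr : πBudX κ Φ t p D c mk (gT mk gx κ Φ t p D) (fT mk fx κ Φ t p D) ≤ r) :
    ∀ (x : Site 2) (du : MDir) (j : ℕ) (z : Site 2), du.1 = 0 → du.2 = true → j < P.K →
      P.faceL du.1 j - (((KS0.Rlev0 κ Φ t p D mk + KS0.reach0 t D mk) : ℕ) : ℤ) ≤ P.lev du x z → P.lev du x z ≤ P.faceL du.1 j + (((KS0.Rlev0 κ Φ t p D mk + KS0.reach0 t D mk) : ℕ) : ℤ) →
      |z (oth du.1) - (P.cenS x (oth du.1) + P.faceSh du)| ≤ kE →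
      Skelφ.FloorsX2V (prFA κ Φ t p D (gT mk gx κ Φ t p D) (fT mk fx κ Φ t p D)) (nL κ Φ t p D (gT mk gx κ Φ t p D) (fT mk fx κ Φ t p D)) (u₀A κ Φ t p D (gT mk gx κ Φ t p D) (fT mk fx κ Φ t p D)) (u₁A κ Φ t p D (gT mk gx κ Φ t p D) (fT mk fx κ Φ t p D))
      (modulus (nL κ Φ t p D (gT mk gx κ Φ t p D) (fT mk fx κ Φ t p D)) (hL κ Φ t p D (gT mk gx κ Φ t p D) (fT mk fx κ Φ t p D)) (vL κ Φ t p D (gT mk gx κ Φ t p D) (fT mk fx κ Φ t p D)) (vβL κ Φ t p D (gT mk gx κ Φ t p D) (fT mk fx κ Φ t p D))) (nL κ Φ t p D (gT mk gx κ Φ t p D) (fT mk fx κ Φ t p D) : ℤ) (ℓL κ Φ t p D (gT mk gx κ Φ t p D) (fT mk fx κ Φ t p D))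
      P (NegB.BSlot.small3 κ Φ t p D (gT mk gx κ Φ t p D) (fT mk fx κ Φ t p D)) x du j 3 r (Mu D) z
      (fun i => if i = 0 then kF₀A κ Φ t p D c mk (gT mk gx κ Φ t p D) (fT mk fx κ Φ t p D) else kF₁A κ Φ t p D c mk (gT mk gx κ Φ t p D) (fT mk fx κ Φ t p D))
      (BFs κ Φ t p D c mk (gT mk gx κ Φ t p D) (fT mk fx κ Φ t p D) (sgOf du)) (KS0.R'0 κ Φ t p D mk) (qBXFs κ Φ t p D mk) (KS0.R'0 κ Φ t p D mk) (qB3XA κ Φ t p D (gT mk gx κ Φ t p D) (fT mk fx κ Φ t p D) (KS0.R'0 κ Φ t p D mk))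
      (yLXFs κ Φ t p D c mk (gT mk gx κ Φ t p D) (fT mk fx κ Φ t p D) (sgOf du)) (min (NrX κ Φ t p D (gT mk gx κ Φ t p D) (fT mk fx κ Φ t p D) P.toPCells2T (yLXFs κ Φ t p D c mk (gT mk gx κ Φ t p D) (fT mk fx κ Φ t p D) (sgOf du)) 1 x du z) (600 * Neg.Kq κ - 1)) (min (N3WX κ Φ t p D (gT mk gx κ Φ t p D) (fT mk fx κ Φ t p D) P.toPCells2T (yLXFs κ Φ t p D c mk (gT mk gx κ Φ t p D) (fT mk fx κ Φ t p D) (sgOf du)) x du z (bwX κ Φ t p D (gT mk gx κ Φ t p D) (fT mk fx κ Φ t p D))) (240 * Neg.Kq κ + 9)) 1 := by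
  intro x du j z hd hs hj hlev1 hlev2 hzW
  obtain ⟨-, -, -, hS, -, hMR0, -, -⟩ := slotsF_hyps κ Φ t p D c mk gx fx hgx hfx hN
  obtain ⟨-, -, hEu0, -⟩ := bandF_facts κ Φ t p D c mk gx fx hgx hN hκ
  have hd' : du.1 = 0 := hd
  have hP' : P.toPCells2T.toPCells2 = fcellsA κ Φ t p D (gT mk gx κ Φ t p D) (fT mk fx κ Φ t p D) := hP
  have hzW' : |z 1 - (P.cenS x 1 + P.faceSh du)| ≤ kE := by rw [hd] at hzW; exact hzW
  obtain ⟨hTw, hz'⟩ := hTw_of_shiftedX κ Φ t p D (gT mk gx κ Φ t p D) (fT mk fx κ Φ t p D) P x du hd' hs z hzW' hfwd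
  have hlev1' : (P.toPCells2T.faceL 0 j : ℤ) - (((KS0.Rlev0 κ Φ t p D mk + KS0.reach0 t D mk) : ℕ) : ℤ) ≤ P.toPCells2T.lev du x z := by rw [hd] at hlev1; exact hlev1
  have hlev2' : P.toPCells2T.lev du x z ≤ P.toPCells2T.faceL 0 j + (((KS0.Rlev0 κ Φ t p D mk + KS0.reach0 t D mk) : ℕ) : ℤ) := by rw [hd] at hlev2; exact hlev2
  obtain ⟨hNr, hN3⟩ := rangesX_XFsW κ Φ t p D c mk gx fx P.toPCells2T hP' hN hκ hS hMR0 x du hd' j hj z hlev1' hlev2' hz' hEu0 hkEr hTw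
  rw [Nat.min_eq_left (Nat.le_sub_one_of_lt (Nat.lt_of_succ_le hNr)), Nat.min_eq_left (Nat.lt_succ_iff.mp (Nat.lt_of_succ_le hN3))]
  exact floorsX_XFs_FW κ Φ t p D c mk gx fx hgx hfx hN hκ P hP hkEr hkE2 hfwd r hr x du j z hd hs hj hlev1 hlev2 hzW

/-- **The one-sided x-face witnesses' stride budget** `0 + 1 + NrF + 1 + N3F ≤ nB` for any `nB ≥ 840·Kq + 10`. [folklore] -/
theorem capX_pkgFW (κ : Consts) {V : Type} [DecidableEq V] [Countable V] {G : SimpleGraph V} [G.LocallyFinite] (Φ : PlanarSkeletonFrm G) (t : V) (p : unitInterval) (D : Skelφ.StepI.DataNS V) (c mk : ℕ) (gx fx : Neg.FSlot) (P : PCells2V) {nB : ℕ} (hnB : 840 * Neg.Kq κ + 10 ≤ nB)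
    (x : Site 2) (du : MDir) (z : Site 2) :
    0 + 1 + (min (NrX κ Φ t p D (gT mk gx κ Φ t p D) (fT mk fx κ Φ t p D) P.toPCells2T (yLXFs κ Φ t p D c mk (gT mk gx κ Φ t p D) (fT mk fx κ Φ t p D) (sgOf du)) 1 x du z) (600 * Neg.Kq κ - 1)) + 1 + (min (N3WX κ Φ t p D (gT mk gx κ Φ t p D) (fT mk fx κ Φ t p D) P.toPCells2T (yLXFs κ Φ t p D c mk (gT mk gx κ Φ t p D) (fT mk fx κ Φ t p D) (sgOf du)) x du z (bwX κ Φ t p D (gT mk gx κ Φ t p D) (fT mk fx κ Φ t p D))) (240 * Neg.Kq κ + 9)) ≤ nB := by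
  have h1 := Nat.min_le_right (NrX κ Φ t p D (gT mk gx κ Φ t p D) (fT mk fx κ Φ t p D) P.toPCells2T (yLXFs κ Φ t p D c mk (gT mk gx κ Φ t p D) (fT mk fx κ Φ t p D) (sgOf du)) 1 x du z) (600 * Neg.Kq κ - 1)
  have h2 := Nat.min_le_right (N3WX κ Φ t p D (gT mk gx κ Φ t p D) (fT mk fx κ Φ t p D) P.toPCells2T (yLXFs κ Φ t p D c mk (gT mk gx κ Φ t p D) (fT mk fx κ Φ t p D) (sgOf du)) x du z (bwX κ Φ t p D (gT mk gx κ Φ t p D) (fT mk fx κ Φ t p D))) (240 * Neg.Kq κ + 9)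
  have hq := Neg.one_le_Kq κ
  omega

set_option maxHeartbeats 1600000 in
/-- **THE ONE-SIDED y′-FACE FLOOR PACKAGE WITH CAPPED WITNESSES**, hop side `1` (`NrF′ := min NrY (600·Kq − 1)`, `N3F′ := min (N3WY … yT …) (240·Kq + 9)`).
[cite: KozmaNitzan2024, §4 Lemma 11–12 (pp. 21–25)] -/
theorem floorsY_pkgFW (κ : Consts) {V : Type} [DecidableEq V] [Countable V] {G : SimpleGraph V} [G.LocallyFinite] (Φ : PlanarSkeletonFrm G) (t : V) (p : unitInterval) (D : Skelφ.StepI.DataNS V) (c mk : ℕ) (gx fx : Neg.FSlot)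
    (hgx : ∀ D : DataNS V, gxFc mk c κ Φ t p D ≤ gx κ Φ t p D) (hfx : ∀ D : DataNS V, fxFc mk κ Φ t p D ≤ fx κ Φ t p D)
    (hN : EqNumL κ Φ t p D (gT mk gx κ Φ t p D) (fT mk fx κ Φ t p D)) (hκ : (hL κ Φ t p D (gT mk gx κ Φ t p D) (fT mk fx κ Φ t p D)).natAbs ≤ 10 * nL κ Φ t p D (gT mk gx κ Φ t p D) (fT mk fx κ Φ t p D))
    (P : PCells2V) (hP : P.toPCells2 = fcellsA κ Φ t p D (gT mk gx κ Φ t p D) (fT mk fx κ Φ t p D)) {kE : ℤ}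
    (hkE : kE + (P.r 0 : ℤ) ≤ 5 * (P.r 0 : ℤ))
    (hkE8 : kE + (P.r 0 : ℤ) + 8 * u₀A κ Φ t p D (gT mk gx κ Φ t p D) (fT mk fx κ Φ t p D) + 8 + P.c 1 ≤ 5 * (P.r 0 : ℤ))
    (hkE24 : 2 * (kE + (P.r 0 : ℤ)) + 24 * u₀A κ Φ t p D (gT mk gx κ Φ t p D) (fT mk fx κ Φ t p D) + 24 + 2 * (P.c 1 : ℤ) ≤ 5 * (P.r 0 : ℤ))
    (hfwd : 2 * kE + (P.hF 1 : ℤ) - P.hB 1 + 14 * u₀A κ Φ t p D (gT mk gx κ Φ t p D) (fT mk fx κ Φ t p D) ≤ 2 * ((P.c 1 : ℤ) + (bwY κ Φ t p D (gT mk gx κ Φ t p D) (fT mk fx κ Φ t p D))))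
    (hv0 : 0 ≤ vL κ Φ t p D (gT mk gx κ Φ t p D) (fT mk fx κ Φ t p D)) (hc : 600 * Neg.Kq κ ≤ c)
    (r : ℕ) (hr : πBudY κ Φ t p D c mk (gT mk gx κ Φ t p D) (fT mk fx κ Φ t p D) ≤ r) :
    ∀ (x : Site 2) (du : MDir) (j : ℕ) (z : Site 2), du.1 = 1 → du.2 = true → j < P.K →
      P.faceL du.1 j - (((KS0.Rlev0 κ Φ t p D mk + KS0.reach0 t D mk) : ℕ) : ℤ) ≤ P.lev du x z → P.lev du x z ≤ P.faceL du.1 j + (((KS0.Rlev0 κ Φ t p D mk + KS0.reach0 t D mk) : ℕ) : ℤ) →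
      |z (oth du.1) - (P.cenS x (oth du.1) + P.faceSh du)| ≤ kE →
      Skelφ.FloorsY2V (prFA κ Φ t p D (gT mk gx κ Φ t p D) (fT mk fx κ Φ t p D)) (nL κ Φ t p D (gT mk gx κ Φ t p D) (fT mk fx κ Φ t p D)) (u₀A κ Φ t p D (gT mk gx κ Φ t p D) (fT mk fx κ Φ t p D)) (u₁A κ Φ t p D (gT mk gx κ Φ t p D) (fT mk fx κ Φ t p D))
      (modulus (nL κ Φ t p D (gT mk gx κ Φ t p D) (fT mk fx κ Φ t p D)) (hL κ Φ t p D (gT mk gx κ Φ t p D) (fT mk fx κ Φ t p D)) (vL κ Φ t p D (gT mk gx κ Φ t p D) (fT mk fx κ Φ t p D)) (vβL κ Φ t p D (gT mk gx κ Φ t p D) (fT mk fx κ Φ t p D))) (nL κ Φ t p D (gT mk gx κ Φ t p D) (fT mk fx κ Φ t p D) : ℤ) (ℓL κ Φ t p D (gT mk gx κ Φ t p D) (fT mk fx κ Φ t p D))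
      P (NegB.BSlot.small3 κ Φ t p D (gT mk gx κ Φ t p D) (fT mk fx κ Φ t p D)) x du j 3 r (Mu D) z
      (fun i => if i = 0 then kF₀A κ Φ t p D c mk (gT mk gx κ Φ t p D) (fT mk fx κ Φ t p D) else kF₁A κ Φ t p D c mk (gT mk gx κ Φ t p D) (fT mk fx κ Φ t p D))
      1 (BFs κ Φ t p D c mk (gT mk gx κ Φ t p D) (fT mk fx κ Φ t p D) 1) (KS0.R'0 κ Φ t p D mk) (qBF κ Φ t p D c mk (gT mk gx κ Φ t p D) (fT mk fx κ Φ t p D)) (KS0.R'0 κ Φ t p D mk) (qB3YA κ Φ t p D (gT mk gx κ Φ t p D) (fT mk fx κ Φ t p D) (KS0.R'0 κ Φ t p D mk))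
      (yLFs κ Φ t p D c mk (gT mk gx κ Φ t p D) (fT mk fx κ Φ t p D) (sgOf du) 1) (min (NrY κ Φ t p D (gT mk gx κ Φ t p D) (fT mk fx κ Φ t p D) P.toPCells2T (yLFs κ Φ t p D c mk (gT mk gx κ Φ t p D) (fT mk fx κ Φ t p D) (sgOf du) 1) x du z) (600 * Neg.Kq κ - 1)) (min (N3WY κ Φ t p D (gT mk gx κ Φ t p D) (fT mk fx κ Φ t p D) P.toPCells2T ((yLFs κ Φ t p D c mk (gT mk gx κ Φ t p D) (fT mk fx κ Φ t p D) (sgOf du) 1) + Skelφ.crossOffY (nL κ Φ t p D (gT mk gx κ Φ t p D) (fT mk fx κ Φ t p D)) (ℓL κ Φ t p D (gT mk gx κ Φ t p D) (fT mk fx κ Φ t p D)) (hL κ Φ t p D (gT mk gx κ Φ t p D) (fT mk fx κ Φ t p D)) (vL κ Φ t p D (gT mk gx κ Φ t p D) (fT mk fx κ Φ t p D)) (sgOf du) (NrY κ Φ t p D (gT mk gx κ Φ t p D) (fT mk fx κ Φ t p D) P.toPCells2T (yLFs κ Φ t p D c mk (gT mk gx κ Φ t p D) (fT mk fx κ Φ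 t p D) (sgOf du) 1) x du z)) x du z (bwY κ Φ t p D (gT mk gx κ Φ t p D) (fT mk fx κ Φ t p D))) (240 * Neg.Kq κ + 9)) 1 := by
  intro x du j z hd hs hj hlev1 hlev2 hzW
  obtain ⟨-, -, hℓA, hS, -, hMR0, -, -⟩ := slotsF_hyps κ Φ t p D c mk gx fx hgx hfx hN
  obtain ⟨hs0, -, -, -, -⟩ := cellsF_hyps κ Φ t p D c mk gx fx hgx hN hκ
  obtain ⟨-, -, -, hEu1⟩ := bandF_facts κ Φ t p D c mk gx fx hgx hN hκ
  have hd' : du.1 = 1 := hd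
  have hP' : P.toPCells2T.toPCells2 = fcellsA κ Φ t p D (gT mk gx κ Φ t p D) (fT mk fx κ Φ t p D) := hP
  have hzW' : |z 0 - (P.cenS x 0 + P.faceSh du)| ≤ kE := by rw [hd] at hzW; exact hzW
  obtain ⟨hTw, hz'⟩ := hTw_of_shiftedY κ Φ t p D (gT mk gx κ Φ t p D) (fT mk fx κ Φ t p D) P x du hd' hs z hzW' hfwd
  have hlev1' : (P.toPCells2T.faceL 1 j : ℤ) - (((KS0.Rlev0 κ Φ t p D mk + KS0.reach0 t D mk) : ℕ) : ℤ) ≤ P.toPCells2T.lev du x z := by rw [hd] at hlev1; exact hlev1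
  have hlev2' : P.toPCells2T.lev du x z ≤ P.toPCells2T.faceL 1 j + (((KS0.Rlev0 κ Φ t p D mk + KS0.reach0 t D mk) : ℕ) : ℤ) := by rw [hd] at hlev2; exact hlev2
  obtain ⟨hNr, hN3⟩ := rangesY_YFsW κ Φ t p D c mk gx fx P.toPCells2T hP' hN hκ hS hMR0 x du hd' j hj z hlev1' hlev2' hz' hEu1 hkE hℓA hs0 1 (Or.inl rfl) hTw
  rw [Nat.min_eq_left (Nat.le_sub_one_of_lt (Nat.lt_of_succ_le hNr)), Nat.min_eq_left (Nat.lt_succ_iff.mp (Nat.lt_of_succ_le hN3))]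
  exact floorsY_YFs_FW κ Φ t p D c mk gx fx hgx hfx hN hκ P hP hkE hkE8 hkE24 hfwd hv0 hc r hr x du j z hd hs hj hlev1 hlev2 hzW

/-- **The one-sided y′-face witnesses' stride budget** `0 + 1 + NrF′ + 1 + N3F′ ≤ nB` for any `nB ≥ 840·Kq + 10`. [folklore] -/
theorem capY_pkgFW (κ : Consts) {V : Type} [DecidableEq V] [Countable V] {G : SimpleGraph V} [G.LocallyFinite] (Φ : PlanarSkeletonFrm G) (t : V) (p : unitInterval) (D : Skelφ.StepI.DataNS V) (c mk : ℕ) (gx fx : Neg.FSlot) (P : PCells2V) {nB : ℕ} (hnB : 840 * Neg.Kq κ + 10 ≤ nB)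
    (x : Site 2) (du : MDir) (z : Site 2) :
    0 + 1 + (min (NrY κ Φ t p D (gT mk gx κ Φ t p D) (fT mk fx κ Φ t p D) P.toPCells2T (yLFs κ Φ t p D c mk (gT mk gx κ Φ t p D) (fT mk fx κ Φ t p D) (sgOf du) 1) x du z) (600 * Neg.Kq κ - 1)) + 1 + (min (N3WY κ Φ t p D (gT mk gx κ Φ t p D) (fT mk fx κ Φ t p D) P.toPCells2T ((yLFs κ Φ t p D c mk (gT mk gx κ Φ t p D) (fT mk fx κ Φ t p D) (sgOf du) 1) + Skelφ.crossOffY (nL κ Φ t p D (gT mk gx κ Φ t p D) (fT mk fx κ Φ t p D)) (ℓL κ Φ t p D (gT mk gx κ Φ t p D) (fT mk fx κ Φ t p D)) (hL κ Φ t p D (gT mk gx κ Φ t p D) (fT mk fx κ Φ t p D)) (vL κ Φ t p D (gT mk gx κ Φ t p D) (fT mk fx κ Φ t p D)) (sgOf du) (NrY κ Φ t p D (gT mk gx κ Φ t p D) (fT mk fx κ Φ t p D) P.toPCells2T (yLFs κ Φ t p D c mk (gT mk gx κ Φ t p D) (fT mk fx κ Φ t p D) (sgOf du) 1) x du z)) x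 du z (bwY κ Φ t p D (gT mk gx κ Φ t p D) (fT mk fx κ Φ t p D))) (240 * Neg.Kq κ + 9)) ≤ nB := by
  have h1 := Nat.min_le_right (NrY κ Φ t p D (gT mk gx κ Φ t p D) (fT mk fx κ Φ t p D) P.toPCells2T (yLFs κ Φ t p D c mk (gT mk gx κ Φ t p D) (fT mk fx κ Φ t p D) (sgOf du) 1) x du z) (600 * Neg.Kq κ - 1)
  have h2 := Nat.min_le_right (N3WY κ Φ t p D (gT mk gx κ Φ t p D) (fT mk fx κ Φ t p D) P.toPCells2T ((yLFs κ Φ t p D c mk (gT mk gx κ Φ t p D) (fT mk fx κ Φ t p D) (sgOf du) 1) + Skelφ.crossOffY (nL κ Φ t p D (gT mk gx κ Φ t p D) (fT mk fx κ Φ t p D)) (ℓL κ Φ t p D (gT mk gx κ Φ t p D) (fT mk fx κ Φ t p D)) (hL κ Φ t p D (gT mk gx κ Φ t p D) (fT mk fx κ Φ t p D)) (vL κ Φ t p D (gT mk gx κ Φ t p D) (fT mk fx κ Φ t p D)) (sgOf du) (NrY κ Φ t p D (gT mk gx κ Φ t p D) (fT mk fx κ Φ t p D) P.toPCells2T (yLFs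 κ Φ t p D c mk (gT mk gx κ Φ t p D) (fT mk fx κ Φ t p D) (sgOf du) 1) x du z)) x du z (bwY κ Φ t p D (gT mk gx κ Φ t p D) (fT mk fx κ Φ t p D))) (240 * Neg.Kq κ + 9)
  have hq := Neg.one_le_Kq κ
  omega

end KS

end NegB

end PlanarSkeletonFrm

end Summit.CriticalPhenomena.PercolationContinuityZ3.Theorems.Transplant

end
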